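import Literature.MathematicalPhysics.QuantumFieldTheory.TorusChartPinnedGaussian
import Literature.Probability.Distributions.GaussianLinearCompensation
import HarnessLib

/-!
# Pinned versus translation-invariant Gaussian fields: the gradient laws coincide

Let `H` be a real symmetric matrix on the sites `Λ` of a finite lattice with `H 1 = 0` (a shift-invariant
quadratic form `⟨φ, Hφ⟩`, e.g. the Hessian of a gradient action) whose principal submatrix
`H' = H|_{Λ∖0}` is positive definite (cf. `TorusChart.posDef_submatrix_of_d₀_coercive`).  There are two
natural centred Gaussian fields attached to `H`:

* the **pinned field** `ψ : Λ ∖ 0 → ℝ` with precision `H'`, i.e. `N(0, (H')⁻¹)` — this is how the field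
  arrives after the `U(1)` gauge fixing `φ(0) = 0` of an unfolded lattice integral
  (`TorusChartPinnedGaussian.lean`, `GaussianWeightExpectation.lean`);
* the **translation-invariant field** `φ : Λ → ℝ` with any positive semidefinite covariance `G` that is a
  generalised inverse of `H` on the mean-zero functions, `H (G f) = f` whenever `Σ f = 0` (e.g. the
  pseudo-inverse / Green's operator of `H`, the object finite-range decompositions act on).

**They have the same gradient law**: for every matrix `T` whose rows sum to zero (every "gradient-type"
linear observable, in particular the lattice gradient `d₀` of a torus chart), the image of `N(0, (H')⁻¹)`
under `ψ ↦ T (extZero ψ)` equals the image of `N(0, G)` under `φ ↦ T φ`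
(`map_matrixCLM_pinned_eq_map_matrixCLM`, `map_d₀_pinned_eq_map_d₀`).  The algebraic heart is
`restrict_dotProduct_inv_submatrix_mulVec`: `f|' ⋅ (H')⁻¹ g|' = f ⋅ G g` for mean-zero `f, g`.

Everything is proved; no named fact is introduced.

## References

* J. Fröhlich, T. Spencer, Comm. Math. Phys. 81 (1981) 527–602, §2 (massless lattice Gaussian field modulo
  constants). [folklore form]
* D. Brydges, *Lectures on the renormalisation group* (Park City 2007), §2.1 (massless Gaussian field on the
  torus as a measure on gradients). [folklore form]
-/

noncomputable section

namespace Literature.MathematicalPhysics.QuantumFieldTheory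

open scoped BigOperators
open MeasureTheory ProbabilityTheory Matrix WithLp Literature.Probability.Distributions

namespace TorusChart

/-! ## Extension by zero and restriction as matrices -/

section ExtMatrix

variable (Λ : Type*) [Fintype Λ] [DecidableEq Λ] [Zero Λ]

/-- The matrix of **extension by zero at the origin**, `Λ × (Λ ∖ 0)`: `E x j = [x = j]`. [folklore] -/
def extMatrix : Matrix Λ (Punctured Λ) ℝ := Matrix.of fun x j => if x = j.1 then 1 else 0

variable {Λ}

/-- `E ψ = extZero ψ`. [folklore] -/
@[simp] theorem extMatrix_mulVec (ψ : Punctured Λ → ℝ) : extMatrix Λ *ᵥ ψ = extZero ψ := by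
  funext x
  simp only [extMatrix, Matrix.mulVec, dotProduct, Matrix.of_apply, ite_mul, one_mul, zero_mul]
  by_cases hx : x = 0
  · subst hx
    rw [extZero_zero]
    exact Finset.sum_eq_zero fun j _ => if_neg (Ne.symm j.2)
  · rw [extZero_of_ne ψ hx, Finset.sum_eq_single ⟨x, hx⟩ (fun j _ hj => if_neg fun h => hj (Subtype.ext h.symm))
      (fun h => (h (Finset.mem_univ _)).elim), if_pos rfl]

/-- `Eᵀ f` is the restriction of `f` to `Λ ∖ 0`. [folklore] -/
@[simp] theorem transpose_extMatrix_mulVec (f : Λ → ℝ) :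
    (extMatrix Λ)ᵀ *ᵥ f = fun j : Punctured Λ => f j.1 := by
  funext j
  simp only [extMatrix, Matrix.mulVec, dotProduct, Matrix.transpose_apply, Matrix.of_apply, ite_mul, one_mul,
    zero_mul]
  rw [Finset.sum_ite_eq' Finset.univ j.1 f, if_pos (Finset.mem_univ _)]

end ExtMatrix

/-! ## The pinned inverse versus a generalised inverse on mean-zero functions -/

section LinearAlgebra

variable {Λ : Type*} [Fintype Λ] [DecidableEq Λ] [Zero Λ]

/-- **Pinned solve.** If `H u = g` and `u 0 = 0` then the restriction of `u` solves the pinned system: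
`H' (u|') = g|'` with `H' = H|_{Λ∖0}`. [folklore] -/
theorem submatrix_mulVec_restrict {H : Matrix Λ Λ ℝ} {u g : Λ → ℝ} (hu : u 0 = 0) (h : H *ᵥ u = g) :
    (H.submatrix Subtype.val Subtype.val : Matrix (Punctured Λ) (Punctured Λ) ℝ) *ᵥ (fun j : Punctured Λ => u j.1) =
      fun j : Punctured Λ => g j.1 := by
  funext j
  have hj : (H *ᵥ u) j.1 = g j.1 := by rw [h]
  rw [← hj]
  simp only [Matrix.mulVec, dotProduct, Matrix.submatrix_apply]
  rw [sum_eq_sum_punctured (fun y => H j.1 y * u y) (by rw [hu, mul_zero])]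

/-- **The pinned inverse and any generalised inverse agree as forms on mean-zero functions.** Let `H 1 = 0`,
`H' = H|_{Λ∖0}` positive definite, and `H (G g) = g` for all mean-zero `g`.  Then for mean-zero `f, g`:
`f|' ⋅ (H')⁻¹ g|' = f ⋅ G g`. (Proof: `u = G g` shifted to vanish at `0` still solves `H u = g`, so its
restriction is `(H')⁻¹ g|'`; pairing with `f` the shift drops out because `Σ f = 0`.) [folklore] -/
theorem restrict_dotProduct_inv_submatrix_mulVec {H G : Matrix Λ Λ ℝ} (h1 : H *ᵥ (fun _ => (1 : ℝ)) = 0)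
    (hH' : (H.submatrix Subtype.val Subtype.val : Matrix (Punctured Λ) (Punctured Λ) ℝ).PosDef)
    (hG : ∀ g : Λ → ℝ, ∑ x, g x = 0 → H *ᵥ (G *ᵥ g) = g) {f g : Λ → ℝ} (hf : ∑ x, f x = 0)
    (hg : ∑ x, g x = 0) :
    (fun j : Punctured Λ => f j.1) ⬝ᵥ (H.submatrix Subtype.val Subtype.val : Matrix (Punctured Λ) (Punctured Λ) ℝ)⁻¹ *ᵥ (fun j : Punctured Λ => g j.1) =
      f ⬝ᵥ G *ᵥ g := by
  set u : Λ → ℝ := G *ᵥ g with hu_def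
  set u' : Λ → ℝ := fun x => u x - u 0 with hu'_def
  have hu'0 : u' 0 = 0 := sub_self _
  -- `H u' = g`
  have hHu' : H *ᵥ u' = g := by
    have hsplit : u' = u - u 0 • (fun _ => (1 : ℝ)) := by
      funext x; simp [hu'_def]
    rw [hsplit, Matrix.mulVec_sub, Matrix.mulVec_smul, h1, smul_zero, sub_zero, hu_def]
    exact hG g hg
  -- hence `u'|' = (H')⁻¹ g|'`
  have hsolve := submatrix_mulVec_restrict hu'0 hHu'
  have hdet : IsUnit (H.submatrix Subtype.val Subtype.val : Matrix (Punctured Λ) (Punctured Λ) ℝ).det :=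
    (Matrix.isUnit_iff_isUnit_det _).1 hH'.isUnit
  have hinv : (H.submatrix Subtype.val Subtype.val : Matrix (Punctured Λ) (Punctured Λ) ℝ)⁻¹ *ᵥ (fun j : Punctured Λ => g j.1) =
      fun j : Punctured Λ => u' j.1 := by
    rw [← hsolve, Matrix.mulVec_mulVec, Matrix.nonsing_inv_mul _ hdet, Matrix.one_mulVec]
  rw [hinv]
  -- pair with `f`: the shift by `u 0` drops out since `Σ f = 0`
  have hsum : (fun j : Punctured Λ => f j.1) ⬝ᵥ (fun j : Punctured Λ => u' j.1) = ∑ x, f x * u' x := by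
    rw [dotProduct, sum_eq_sum_punctured (fun x => f x * u' x) (by rw [hu'0, mul_zero])]
  rw [hsum]
  simp only [hu'_def, mul_sub, Finset.sum_sub_distrib, ← Finset.sum_mul, hf, zero_mul, sub_zero]
  rfl

omit [DecidableEq Λ] [Zero Λ] in
/-- An entry of `T X Tᵀ` is the form `X` evaluated on two rows of `T`. [folklore] -/
theorem mul_mul_transpose_apply {κ : Type*} (T : Matrix κ Λ ℝ) (X : Matrix Λ Λ ℝ) (a b : κ) :
    (T * X * Tᵀ) a b = T a ⬝ᵥ X *ᵥ T b := by
  simp only [Matrix.mul_apply, Matrix.transpose_apply, dotProduct, Matrix.mulVec, Finset.sum_mul,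
    Finset.mul_sum]
  rw [Finset.sum_comm]
  refine Finset.sum_congr rfl fun x _ => Finset.sum_congr rfl fun y _ => ?_
  ring

omit [DecidableEq Λ] [Zero Λ] in
/-- The form of `E Y Eᵀ` is the form of `Y` on the `Eᵀ`-images. [folklore] -/
theorem dotProduct_mul_mul_transpose_mulVec {μ : Type*} [Fintype μ] (E : Matrix Λ μ ℝ) (Y : Matrix μ μ ℝ)
    (u w : Λ → ℝ) : u ⬝ᵥ (E * Y * Eᵀ) *ᵥ w = (Eᵀ *ᵥ u) ⬝ᵥ Y *ᵥ (Eᵀ *ᵥ w) := by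
  rw [← Matrix.mulVec_mulVec, ← Matrix.mulVec_mulVec, Matrix.dotProduct_mulVec, ← Matrix.mulVec_transpose]

/-- **Matrix form.** For every matrix `T` whose rows sum to zero (`T 1 = 0`):
`T (E (H')⁻¹ Eᵀ) Tᵀ = T G Tᵀ`, where `E` is extension by zero. [folklore] -/
theorem mul_extMatrix_inv_submatrix_eq {κ : Type*} {H G : Matrix Λ Λ ℝ}
    (h1 : H *ᵥ (fun _ => (1 : ℝ)) = 0)
    (hH' : (H.submatrix Subtype.val Subtype.val : Matrix (Punctured Λ) (Punctured Λ) ℝ).PosDef)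
    (hG : ∀ g : Λ → ℝ, ∑ x, g x = 0 → H *ᵥ (G *ᵥ g) = g) (T : Matrix κ Λ ℝ)
    (hT : T *ᵥ (fun _ => (1 : ℝ)) = 0) :
    T * (extMatrix Λ * (H.submatrix Subtype.val Subtype.val : Matrix (Punctured Λ) (Punctured Λ) ℝ)⁻¹ * (extMatrix Λ)ᵀ) * Tᵀ =
      T * G * Tᵀ := by
  ext a b
  have hrow : ∀ c : κ, ∑ x, T c x = 0 := fun c => by
    have := congr_fun hT c
    simpa [Matrix.mulVec, dotProduct] using this
  rw [mul_mul_transpose_apply, mul_mul_transpose_apply, dotProduct_mul_mul_transpose_mulVec,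
    transpose_extMatrix_mulVec, transpose_extMatrix_mulVec]
  exact restrict_dotProduct_inv_submatrix_mulVec h1 hH' hG (hrow a) (hrow b)

end LinearAlgebra

/-! ## The Gaussian statement -/

section Gaussian

variable {Λ : Type} [Fintype Λ] [DecidableEq Λ] [Zero Λ]

/-- **Pinned and translation-invariant Gaussian fields have the same law of zero-sum linear observables.**
With `H 1 = 0`, `H' = H|_{Λ∖0}` positive definite, `G` positive semidefinite with `H (G g) = g` for mean-zero
`g`, and `T` any matrix with `T 1 = 0`: the image of the pinned Gaussian `N(0, (H')⁻¹)` under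
`ψ ↦ T (extZero ψ)` is the image of `N(0, G)` under `φ ↦ T φ` (both equal `N(0, T G Tᵀ)`). [folklore] -/
theorem map_matrixCLM_pinned_eq_map_matrixCLM {κ : Type} [Fintype κ] [DecidableEq κ] {H G : Matrix Λ Λ ℝ}
    (h1 : H *ᵥ (fun _ => (1 : ℝ)) = 0)
    (hH' : (H.submatrix Subtype.val Subtype.val : Matrix (Punctured Λ) (Punctured Λ) ℝ).PosDef)
    (hGpsd : G.PosSemidef) (hG : ∀ g : Λ → ℝ, ∑ x, g x = 0 → H *ᵥ (G *ᵥ g) = g) (T : Matrix κ Λ ℝ)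
    (hT : T *ᵥ (fun _ => (1 : ℝ)) = 0) :
    (multivariateGaussian 0 (H.submatrix Subtype.val Subtype.val : Matrix (Punctured Λ) (Punctured Λ) ℝ)⁻¹).map
        (matrixCLM (T * extMatrix Λ)) =
      (multivariateGaussian 0 G).map (matrixCLM T) := by
  rw [multivariateGaussian_map_matrix hH'.inv.posSemidef, multivariateGaussian_map_matrix hGpsd]
  congr 1
  have key := mul_extMatrix_inv_submatrix_eq h1 hH' hG T hT
  rw [Matrix.transpose_mul]
  simp only [Matrix.mul_assoc] at key ⊢
  exact key

/-- The two maps in coordinates: `T (E ψ) = T (extZero ψ)`. [folklore] -/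
theorem ofLp_matrixCLM_mul_extMatrix {κ : Type} [Fintype κ] (T : Matrix κ Λ ℝ)
    (ψ : EuclideanSpace ℝ (Punctured Λ)) :
    ofLp (matrixCLM (T * extMatrix Λ) ψ) = T *ᵥ extZero (ofLp ψ) := by
  rw [ofLp_matrixCLM, ← Matrix.mulVec_mulVec, extMatrix_mulVec]

end Gaussian

/-! ## Specialisation to the lattice gradient of a torus chart -/

section Gradient

variable {Λ : Type} [AddCommGroup Λ] [Fintype Λ] [DecidableEq Λ] {d : ℕ} (F : TorusChart Λ d)

/-- The matrix of the lattice gradient `d₀`, rows indexed by edges `(x, i)`: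
`D (x,i) y = [y = x + e_i] - [y = x]`. [folklore] -/
def gradMatrix : Matrix (Λ × Fin d) Λ ℝ :=
  Matrix.of fun p y => (if y = p.1 + F.gen p.2 then 1 else 0) - (if y = p.1 then 1 else 0)

/-- `D φ = d₀ φ`. [folklore] -/
@[simp] theorem gradMatrix_mulVec (φ : Λ → ℝ) : F.gradMatrix *ᵥ φ = fun p => F.d₀ φ p.1 p.2 := by
  funext p
  simp only [gradMatrix, Matrix.mulVec, dotProduct, Matrix.of_apply, sub_mul, ite_mul, one_mul, zero_mul,
    Finset.sum_sub_distrib, Finset.sum_ite_eq' Finset.univ, Finset.mem_univ, if_true, d₀_apply]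

/-- The rows of `D` sum to zero: `D 1 = 0`. [folklore] -/
theorem gradMatrix_mulVec_one : F.gradMatrix *ᵥ (fun _ => (1 : ℝ)) = 0 := by
  rw [gradMatrix_mulVec]
  funext p
  simp [d₀_apply]

/-- **The pinned and the translation-invariant Gaussian field have the same gradient law.** For a
shift-invariant form `H` (`H 1 = 0`) with `H|_{Λ∖0}` positive definite and a positive semidefinite generalised
inverse `G` of `H` on mean-zero functions, the law of `d₀ (extZero ψ)` under `ψ ∼ N(0, (H|_{Λ∖0})⁻¹)` equals
the law of `d₀ φ` under `φ ∼ N(0, G)` (as measures on `ℝ^{Λ × Fin d}`). [folklore] -/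
theorem map_d₀_pinned_eq_map_d₀ {H G : Matrix Λ Λ ℝ} (h1 : H *ᵥ (fun _ => (1 : ℝ)) = 0)
    (hH' : (H.submatrix Subtype.val Subtype.val : Matrix (Punctured Λ) (Punctured Λ) ℝ).PosDef)
    (hGpsd : G.PosSemidef) (hG : ∀ g : Λ → ℝ, ∑ x, g x = 0 → H *ᵥ (G *ᵥ g) = g) :
    (multivariateGaussian 0 (H.submatrix Subtype.val Subtype.val : Matrix (Punctured Λ) (Punctured Λ) ℝ)⁻¹).map
        (matrixCLM (F.gradMatrix * extMatrix Λ)) =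
      (multivariateGaussian 0 G).map (matrixCLM F.gradMatrix) :=
  map_matrixCLM_pinned_eq_map_matrixCLM h1 hH' hGpsd hG F.gradMatrix F.gradMatrix_mulVec_one

/-- The pinned gradient map in coordinates: `ψ ↦ ((x,i) ↦ d₀ (extZero ψ) (x,i))`. [folklore] -/
theorem ofLp_matrixCLM_gradMatrix_mul_extMatrix (ψ : EuclideanSpace ℝ (Punctured Λ)) :
    ofLp (matrixCLM (F.gradMatrix * extMatrix Λ) ψ) = fun p => F.d₀ (extZero (ofLp ψ)) p.1 p.2 := by
  rw [ofLp_matrixCLM_mul_extMatrix, gradMatrix_mulVec]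

/-- The translation-invariant gradient map in coordinates: `φ ↦ ((x,i) ↦ d₀ φ (x,i))`. [folklore] -/
theorem ofLp_matrixCLM_gradMatrix (φ : EuclideanSpace ℝ Λ) :
    ofLp (matrixCLM F.gradMatrix φ) = fun p => F.d₀ (ofLp φ) p.1 p.2 := by
  rw [ofLp_matrixCLM, gradMatrix_mulVec]

/-- **Integral form**: expectations of measurable functionals of the gradient agree,
`∫ Φ(d₀ extZero ψ) dN(0,(H|')⁻¹)(ψ) = ∫ Φ(d₀ φ) dN(0,G)(φ)`. [folklore] -/
theorem integral_comp_d₀_pinned_eq {E : Type*} [NormedAddCommGroup E] [NormedSpace ℝ E]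
    {H G : Matrix Λ Λ ℝ} (h1 : H *ᵥ (fun _ => (1 : ℝ)) = 0)
    (hH' : (H.submatrix Subtype.val Subtype.val : Matrix (Punctured Λ) (Punctured Λ) ℝ).PosDef)
    (hGpsd : G.PosSemidef) (hG : ∀ g : Λ → ℝ, ∑ x, g x = 0 → H *ᵥ (G *ᵥ g) = g)
    (Φ : (Λ × Fin d → ℝ) → E) (hΦ : StronglyMeasurable Φ) :
    ∫ ψ, Φ (fun p => F.d₀ (extZero (ofLp ψ)) p.1 p.2)
        ∂(multivariateGaussian 0 (H.submatrix Subtype.val Subtype.val :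
            Matrix (Punctured Λ) (Punctured Λ) ℝ)⁻¹) =
      ∫ φ, Φ (fun p => F.d₀ (ofLp φ) p.1 p.2) ∂(multivariateGaussian 0 G) := by
  have hΦ' : StronglyMeasurable fun z : EuclideanSpace ℝ (Λ × Fin d) => Φ (ofLp z) :=
    hΦ.comp_measurable (PiLp.continuous_ofLp 2 _).measurable
  have h₁ := integral_map (μ := multivariateGaussian 0 (H.submatrix Subtype.val Subtype.val :
      Matrix (Punctured Λ) (Punctured Λ) ℝ)⁻¹)
    (matrixCLM (F.gradMatrix * extMatrix Λ)).continuous.measurable.aemeasurable hΦ'.aestronglyMeasurable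
  have h₂ := integral_map (μ := multivariateGaussian 0 G)
    (matrixCLM F.gradMatrix).continuous.measurable.aemeasurable hΦ'.aestronglyMeasurable
  simp only [ofLp_matrixCLM_gradMatrix_mul_extMatrix, ofLp_matrixCLM_gradMatrix] at h₁ h₂
  rw [← h₁, ← h₂, F.map_d₀_pinned_eq_map_d₀ h1 hH' hGpsd hG]

end Gradient

end TorusChart

end Literature.MathematicalPhysics.QuantumFieldTheory
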